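import Summits.Ventures.LatticeQCDFlow.Scoring.MadrasSokalCoverage
import Summits.Ventures.LatticeQCDFlow.Scoring.MadrasSokalDataWindowCLT

/-!
# The PRINTED BAR at scorer B's DATA-CHOSEN window: the coverage probability of '`τ_{Ŵ}` within `z` printed bars of `τ̂_N(Ŵ_N)`' has GEN-7's fixed-window limit

HONEST FRAMING: exact (Metropolis-corrected) sampling algorithms for lattice gauge theory;
figures of merit are autocorrelation/cost numbers at stated couplings and volumes; no
continuum-physics claim.

Venture `LatticeQCDFlow` (cell pub-lqcd), sub-topic `Scoring`; FANOUT row 16 (`su2-base`), GEN-8.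
NEW WORK of the cell — the docking of GEN-7's `Scoring/MadrasSokalCoverage.tendsto_measure_printedBar`
(window `w` fixed) with GEN-8's `MadrasSokalDataWindow.tendsto_measure_at_msWindow`, the Z-free
per-window consistency of `MadrasSokalDataWindowCLT`, and scorer B's typed selector
(`MadrasSokalWindowSelector`).  No definition; nothing cited as a fact.

* **`tendsto_measure_printedBar_at_msWindowSel`** — block-factor data (`ξ` i.i.d., square-integrable
  lag products, `c(0) ≠ 0`), population curve with a STRICT Madras–Sokal window `w ≤ Wmax` at the
  scorer's `c > 0`, `τ_w ≠ 0`, `Z` the Gaussian limit at window `w`, `z > 0`.  With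
  `Ŵ_N = msWindowSel c Wmax (τ̂_N(·))` and scorer B's printed bar `δτ_B = τ̂ √((4W+2)/N)` read at
  `W = Ŵ_N`: the probability of '`|τ̂_N(Ŵ_N) − τ_{Ŵ_N}| ≤ z δτ_B(Ŵ_N)`' (in its null-safe studentised
  form, GEN-7 `msScale`) converges to `N(0, R/((4w+2) τ_w²))([−z, z])` — EXACTLY the fixed-window limit
  of `tendsto_measure_printedBar` at `W = w`; in particular GEN-7's `nominal_le_printedBar_limit`
  reading ('the printed bar over-covers in the Gaussian model') applies verbatim to what scorer B prints.

NOT CLAIMED: tangential crossings; `w > Wmax`; numbers.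
-/

noncomputable section

open MeasureTheory ProbabilityTheory Filter Finset WithLp Set
open scoped Topology ENNReal RealInnerProductSpace

namespace Summit.Ventures.LatticeQCDFlow.Scoring

section AtWindow

variable {Ω : Type*} [MeasurableSpace Ω] {P : Measure Ω} [IsProbabilityMeasure P]
variable {Ω' : Type*} [MeasurableSpace Ω'] {P' : Measure Ω'} [IsProbabilityMeasure P']
variable {S : Type*} [MeasurableSpace S] {ξ : ℕ → Ω → S} {m : ℕ} {F : (Fin (m + 1) → S) → ℝ}

/-- **THE PRINTED-BAR COVERAGE AT THE DATA-CHOSEN WINDOW.**  See the module docstring. -/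
theorem tendsto_measure_printedBar_at_msWindowSel (hξ : ∀ i, Measurable (ξ i)) (hind : iIndepFun ξ P)
    (hid : ∀ i, IdentDistrib (ξ i) (ξ 0) P P) (hF : Measurable F)
    (h4 : ∀ t, MemLp (fun ω => blockFactor F ξ 0 ω * blockFactor F ξ t ω) 2 P)
    (hσ : P[fun ω => blockFactor F ξ 0 ω * blockFactor F ξ 0 ω] ≠ 0) {c : ℝ} (hc : 0 < c)
    {w Wmax : ℕ} (hwle : w ≤ Wmax)
    (hw : IsStrictMSWindow c (fun W => tauIntWindow (fun t =>
      P[fun ω => blockFactor F ξ 0 ω * blockFactor F ξ t ω]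
        / P[fun ω => blockFactor F ξ 0 ω * blockFactor F ξ 0 ω]) W) w)
    (hτ : tauIntWindow (fun t => P[fun ω => blockFactor F ξ 0 ω * blockFactor F ξ t ω]
        / P[fun ω => blockFactor F ξ 0 ω * blockFactor F ξ 0 ω]) w ≠ 0)
    {Z : Ω' → EuclideanSpace ℝ (Fin (w + 1))} (hZm : AEMeasurable Z P')
    (hZ : ∀ a : EuclideanSpace ℝ (Fin (w + 1)), HasLaw (fun ω' => ⟪a, Z ω'⟫) (gaussianReal 0
      (∑ s : Fin (w + 1), ∑ t : Fin (w + 1),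
        a s * a t * lagProdACov (blockFactor F ξ) P (m + w) s t).toNNReal) P') {z : ℝ} (hz : 0 < z) :
    Tendsto (fun N : ℕ => P {ω |
        |Real.sqrt N
          * (tauIntWindow (fun t => acovHat (blockFactor F ξ) N t ω / acovHat (blockFactor F ξ) N 0 ω)
              (msWindowSel c Wmax (fun W => tauIntWindow (fun t =>
                acovHat (blockFactor F ξ) N t ω / acovHat (blockFactor F ξ) N 0 ω) W))
            - tauIntWindow (fun t => P[fun ω => blockFactor F ξ 0 ω * blockFactor F ξ t ω]
                / P[fun ω => blockFactor F ξ 0 ω * blockFactor F ξ 0 ω])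
              (msWindowSel c Wmax (fun W => tauIntWindow (fun t =>
                acovHat (blockFactor F ξ) N t ω / acovHat (blockFactor F ξ) N 0 ω) W)))
          * msScale (msWindowSel c Wmax (fun W => tauIntWindow (fun t =>
                acovHat (blockFactor F ξ) N t ω / acovHat (blockFactor F ξ) N 0 ω) W))
              (tauIntWindow (fun t => acovHat (blockFactor F ξ) N t ω
                / acovHat (blockFactor F ξ) N 0 ω)
                (msWindowSel c Wmax (fun W => tauIntWindow (fun t =>
                  acovHat (blockFactor F ξ) N t ω / acovHat (blockFactor F ξ) N 0 ω) W)))| ≤ z})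
      atTop
      (𝓝 (gaussianReal 0 (NNReal.mk (msScale w (tauIntWindow (fun t =>
          P[fun ω => blockFactor F ξ 0 ω * blockFactor F ξ t ω]
            / P[fun ω => blockFactor F ξ 0 ω * blockFactor F ξ 0 ω]) w) ^ 2) (sq_nonneg _)
        * (∑ s : Fin (w + 1), ∑ t : Fin (w + 1),
            tauHatGrad w (toLp 2 fun t : Fin (w + 1) =>
              P[fun ω => blockFactor F ξ 0 ω * blockFactor F ξ t ω]) s
            * tauHatGrad w (toLp 2 fun t : Fin (w + 1) =>
              P[fun ω => blockFactor F ξ 0 ω * blockFactor F ξ t ω]) t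
            * lagProdACov (blockFactor F ξ) P (m + w) s t).toNNReal) (Icc (-z) z))) := by
  -- name the curves and the window-indexed events
  set τhat : ℕ → ℕ → Ω → ℝ := fun N W ω => tauIntWindow (fun t => acovHat (blockFactor F ξ) N t ω
      / acovHat (blockFactor F ξ) N 0 ω) W with hτhat
  set τW : ℕ → ℝ := fun W => tauIntWindow (fun t => P[fun ω => blockFactor F ξ 0 ω * blockFactor F ξ t ω]
      / P[fun ω => blockFactor F ξ 0 ω * blockFactor F ξ 0 ω]) W with hτW
  set A : ℕ → ℕ → Set Ω := fun N W =>
    {ω | |Real.sqrt N * (τhat N W ω - τW W) * msScale W (τhat N W ω)| ≤ z} with hA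
  have hfixed := tendsto_measure_printedBar hξ hind hid hF h4 w hσ hτ hZm hZ hz
  have hconv : ∀ W, 1 ≤ W → W ≤ w → TendstoInMeasure P (fun N => τhat N W) atTop fun _ => τW W :=
    fun W _ _ => tendstoInMeasure_tauIntWindow_blockFactor hξ hind hid hF h4 hσ W
  have hsel : ∀ N ω, IsMSWindow c (fun W => τhat N W ω) w →
      msWindowSel c Wmax (fun W => τhat N W ω) = w :=
    fun _ _ h => msWindowSel_eq_of_isMSWindow h hwle
  exact tendsto_measure_at_msWindow (A := A) hfixed hc hw hconv hsel

end AtWindow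

end Summit.Ventures.LatticeQCDFlow.Scoring

end
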